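import Mathlib

/-!
# Crux `SkeletonJ1R` (stmt-NavierStokesRegularity-23610) · line `streamline_kantorovich_R` · stubs L-core / K — FIRST-DERIVATIVE INTERPOLATION
# on a window: `‖y′ t‖ ≤ 2S₀/h + h·S₂` from `‖y‖ ≤ S₀`, `‖y″‖ ≤ S₂` on `[t, t + h]` (or `[t − h, t]`)

Lead `ns-fsr-lead-23610` g0, 2026-08-29.  Generic calculus (Mathlib only; Landau–Kolmogorov on a window with constant `1` instead of `1/2`).
Use in the line: the transport terms `w·Y′`, `(7/4)τ·Y′` of the linearised switched defect are controlled by `sup‖Y‖` and the stiffness-controlled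
`sup‖Y″‖` (window `h ≍ ℓ` in the ball: `ℓ‖Y′‖ ≲ ‖Y‖ + ℓ²‖Y″‖`), both in stub L-core (`CorePinningL`) and in the Lipschitz bookkeeping of stub K.
MODEL rung; nothing here bears on Navier–Stokes regularity.
-/

set_option linter.dupNamespace false -- `NavierStokesRegularity.NavierStokesRegularity` path/namespace repetition is the tree convention
set_option linter.style.longLine false -- statement lines follow the registered skeleton's layout

namespace Summit.NavierStokesRegularity.NavierStokesRegularity.Theorems.SkeletonJ1RFrame

open Set Function Filter Real Topology

variable {E : Type*} [NormedAddCommGroup E] [NormedSpace ℝ E]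

/-- Taylor step with crude remainder: `C²` `y`, `‖y″‖ ≤ S₂` on `[t, t + h]` (`0 ≤ h`) ⇒ `‖y (t + h) − y t − h • y′ t‖ ≤ h² S₂`. [folklore] -/
theorem norm_taylor_two_le {y : ℝ → E} (hy : ContDiff ℝ 2 y) {t h S₂ : ℝ} (hh : 0 ≤ h)
    (hS₂ : ∀ s ∈ Icc t (t + h), ‖iteratedDeriv 2 y s‖ ≤ S₂) : ‖y (t + h) - y t - h • deriv y t‖ ≤ h ^ 2 * S₂ := by
  have hyd : Differentiable ℝ y := hy.differentiable (by norm_num)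
  have hy'C : ContDiff ℝ 1 (deriv y) := (contDiff_succ_iff_deriv.1 (show ContDiff ℝ (1 + 1) y from hy)).2.2
  have hy'd : Differentiable ℝ (deriv y) := hy'C.differentiable (by norm_num)
  have hy2 : iteratedDeriv 2 y = deriv (deriv y) := by rw [iteratedDeriv_succ, iteratedDeriv_one]
  have hS₂0 : 0 ≤ S₂ := (norm_nonneg _).trans (hS₂ t ⟨le_rfl, by linarith⟩)
  -- first: ‖y′ s − y′ t‖ ≤ h S₂ on [t, t+h]
  have h1 : ∀ s ∈ Icc t (t + h), ‖deriv y s - deriv y t‖ ≤ h * S₂ := by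
    intro s hs
    have hmv := Convex.norm_image_sub_le_of_norm_deriv_le (f := deriv y) (fun u _ => hy'd u)
      (fun u hu => by rw [← hy2]; exact hS₂ u hu) (convex_Icc t (t + h)) ⟨le_rfl, by linarith⟩ hs
    calc ‖deriv y s - deriv y t‖ ≤ S₂ * ‖s - t‖ := hmv
      _ ≤ S₂ * h := by
          refine mul_le_mul_of_nonneg_left ?_ hS₂0
          rw [Real.norm_eq_abs, abs_of_nonneg (by linarith [hs.1])]; linarith [hs.2]
      _ = h * S₂ := mul_comm _ _
  -- second: ψ s = y s − (s − t) • y′ t has ‖ψ′‖ ≤ h S₂ on [t, t+h]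
  set ψ : ℝ → E := fun s => y s - (s - t) • deriv y t with hψ
  have hψd : ∀ s, HasDerivAt ψ (deriv y s - deriv y t) s := fun s => by
    have hl : HasDerivAt (fun s : ℝ => (s - t) • deriv y t) ((1:ℝ) • deriv y t) s :=
      ((hasDerivAt_id' s).sub_const t).smul_const (deriv y t)
    rw [one_smul] at hl
    exact (hyd s).hasDerivAt.sub hl
  have h2 := Convex.norm_image_sub_le_of_norm_deriv_le (f := ψ) (fun u _ => (hψd u).differentiableAt)
    (fun u hu => by rw [(hψd u).deriv]; exact h1 u hu) (convex_Icc t (t + h)) ⟨le_rfl, by linarith⟩ ⟨by linarith, le_rfl⟩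
  have hψt : ψ t = y t := by simp [hψ]
  have hψth : ψ (t + h) = y (t + h) - h • deriv y t := by simp [hψ]
  rw [hψt, hψth, show t + h - t = h by ring, Real.norm_eq_abs, abs_of_nonneg hh] at h2
  calc ‖y (t + h) - y t - h • deriv y t‖ = ‖y (t + h) - h • deriv y t - y t‖ := by congr 1; abel
    _ ≤ h * S₂ * h := h2
    _ = h ^ 2 * S₂ := by ring

/-- **Forward-window interpolation.**  `C²` `y`, `0 < h`, `‖y‖ ≤ S₀` and `‖y″‖ ≤ S₂` on `[t, t + h]` ⇒ `‖y′ t‖ ≤ 2S₀/h + h·S₂`. [folklore] -/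
theorem norm_deriv_le_of_window {y : ℝ → E} (hy : ContDiff ℝ 2 y) {t h S₀ S₂ : ℝ} (hh : 0 < h)
    (hS₀ : ∀ s ∈ Icc t (t + h), ‖y s‖ ≤ S₀) (hS₂ : ∀ s ∈ Icc t (t + h), ‖iteratedDeriv 2 y s‖ ≤ S₂) :
    ‖deriv y t‖ ≤ 2 * S₀ / h + h * S₂ := by
  have htay := norm_taylor_two_le hy hh.le hS₂
  have hyt : ‖y t‖ ≤ S₀ := hS₀ t ⟨le_rfl, by linarith⟩
  have hyth : ‖y (t + h)‖ ≤ S₀ := hS₀ (t + h) ⟨by linarith, le_rfl⟩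
  have hkey : h * ‖deriv y t‖ ≤ 2 * S₀ + h ^ 2 * S₂ := by
    calc h * ‖deriv y t‖ = ‖h • deriv y t‖ := by rw [norm_smul, Real.norm_eq_abs, abs_of_pos hh]
      _ = ‖(y (t + h) - y t) - (y (t + h) - y t - h • deriv y t)‖ := by congr 1; abel
      _ ≤ ‖y (t + h) - y t‖ + ‖y (t + h) - y t - h • deriv y t‖ := norm_sub_le _ _
      _ ≤ (‖y (t + h)‖ + ‖y t‖) + h ^ 2 * S₂ := add_le_add (norm_sub_le _ _) htay
      _ ≤ 2 * S₀ + h ^ 2 * S₂ := by linarith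
  rw [div_add' (2 * S₀) (h * S₂) h hh.ne', le_div_iff₀ hh]
  nlinarith

/-- **Backward-window interpolation** (`[t − h, t]`, by time reversal). [folklore] -/
theorem norm_deriv_le_of_window_left {y : ℝ → E} (hy : ContDiff ℝ 2 y) {t h S₀ S₂ : ℝ} (hh : 0 < h)
    (hS₀ : ∀ s ∈ Icc (t - h) t, ‖y s‖ ≤ S₀) (hS₂ : ∀ s ∈ Icc (t - h) t, ‖iteratedDeriv 2 y s‖ ≤ S₂) :
    ‖deriv y t‖ ≤ 2 * S₀ / h + h * S₂ := by
  set z : ℝ → E := fun s => y (-s) with hz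
  have hzC : ContDiff ℝ 2 z := hy.comp contDiff_neg
  have hzd : ∀ s, deriv z s = -deriv y (-s) := fun s => by rw [hz]; exact deriv_comp_neg y s
  have hz2 : ∀ s, iteratedDeriv 2 z s = iteratedDeriv 2 y (-s) := fun s => by
    rw [iteratedDeriv_succ, iteratedDeriv_one, iteratedDeriv_succ, iteratedDeriv_one]
    have : deriv z = fun s => -deriv y (-s) := funext hzd
    rw [this, deriv.fun_neg, deriv_comp_neg (deriv y) s, neg_neg]
  have hw := norm_deriv_le_of_window hzC (t := -t) hh (fun s hs => by
      simpa [hz] using hS₀ (-s) ⟨by linarith [hs.2], by linarith [hs.1]⟩)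
    (fun s hs => by rw [hz2]; exact hS₂ (-s) ⟨by linarith [hs.2], by linarith [hs.1]⟩)
  rwa [hzd, neg_neg, norm_neg] at hw

end Summit.NavierStokesRegularity.NavierStokesRegularity.Theorems.SkeletonJ1RFrame
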